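import Mathlib
import Summits.NavierStokesRegularity.NavierStokesRegularity.Theorems.TypeIQuarterGateScarEnvelopeTypeISatelliteTowerRecurrentTame

/-!
# Satellite tower for crux `ScarEnvelopeTypeI` (stmt-NavierStokesRegularity-23843) — Part Y2–Y5: a tame self-blown-up rooted object is an enveloped one-scar leaf; THE TWO-ENEMY NORMAL FORM

Part Y2–Y5 of nsreg-p3's ROUND-43 artefact (section `Recurrent`, second half): Y2 ★★ `RootObj.envNode_leaf_of_tame_selfBlowup` (tame + self blow-up ⇒
KNSS-enveloped on the whole unit window and a ONE-SCAR LEAF — census shadow of Chae–Wolf 2017 Thm 1.1); Y3–Y5 ★★★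
`DoublyMin.recurrentLeaf_or_selfDescending_rep`, `DoublyMin.selfDescending_of_wild`, `triplyMin_or_selfDescending_of_not_scarEnvelopeTypeI`
(WILD ⇒ the saturated self-descending fixed point; the «enveloped rooted object» escape of X2/X3 closes via Y0 + X1).

PROVENANCE: declaration texts VERBATIM from the HOME artefact of the instrument seat nsreg-p3 g27 (cell `pub/ns-regularity-ideate`):
`round-43/Enemy43.lean` (sha16 `f4e9849cbe2eaa96`, NEW part `partY.lean` f195bf0010977c73 = partY1/partY2/partY3; a module written
against the TREE; memo `round-43/ROUND-43.md` bdd83fd98f0e4a52), scored by referee ref3 g27 (`SCORE-p3-ROUND-43-0828.md`); the author cannot write under `Theorems/`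
(`perm.theorems-prover-only`); landed by the prover ns-es-p1 g5 as landing hand of record (director-ns DIRECTOR-NS #237 (3)), split into
≤ 400-line modules, `E3` spelled out, the artefact's `#guard_msgs … #print axioms` certificates not landed.
`--supports stmt-NavierStokesRegularity-23843 --as helper`.

HONEST FRAMING: instrument theorems about HYPOTHETICAL Type-I zoom limits (Albritton–Barker objects of the census of crux
`TypeIQuarterGate.ScarEnvelopeTypeI`, item 23843); the analytic input is the tree's closure engine (compactness
`local_typeI_compactness_twin_inBall`, sharpened to constant 1 in Part S1; Q1 whole-space), P1 rate inheritance, L8 persistence and the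
tree's PROVED small-constant Liouville theorem; Parts R/S are order theory on the re-classing and closure lemmas.  NOTHING OPEN IS
PROVED: 23843, (L′) `TypeILiouvilleAB` / (L′₀), the GLOBAL (S∞) = `CritAttained`, (M𝐈₁), (E1⁺), (E2ᵣ), route ExtremalTypeIConstant's
cruxes, N0 and Navier–Stokes regularity are OPEN; `critRate`, `levelCrit I`, `liouvilleRate` are `sInf`s that are `0` by junk value
when the defining set is empty (every statement using them carries the nonemptiness hypothesis explicitly).
-/

-- the summit-side namespace repeats a component by design (single-conjunct summit, D-0017)
set_option linter.dupNamespace false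

open MeasureTheory Set Metric Filter Topology
open scoped ENNReal NNReal InnerProductSpace
open Literature.Analysis.FluidPDE

namespace Summit.NavierStokesRegularity.NavierStokesRegularity.Cruxes.ScarEnvelopeTypeI.ZoomDictionary

section Recurrent

variable {U : ℝ → (EuclideanSpace ℝ (Fin 3)) → (EuclideanSpace ℝ (Fin 3))} {P : ℝ → (EuclideanSpace ℝ (Fin 3)) → ℝ} {H : ℝ → (EuclideanSpace ℝ (Fin 3)) → (EuclideanSpace ℝ (Fin 3)) →L[ℝ] (EuclideanSpace ℝ (Fin 3))} {M : ℝ}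

/-! ### Y2. A tame SELF-BLOWN-UP rooted object is enveloped on its whole unit window, and a one-scar leaf -/

/-- ★★ **Y2. SELF-SIMILARITY SPREADS THE ROOT ENVELOPE.**  A rooted A–B object which is TAME at its root and a
ROOT BLOW-UP OF ITSELF (`RootBlowup n n`) is KNSS-enveloped on its WHOLE UNIT WINDOW and has NO satellite in
the open unit ball: tameness gives a local envelope `(A, δ)` at the root (`TowerObj.envelope_of_budgetAt`), the
root tangent inherits it GLOBALLY (`abTower_closed_decay`), and the tangent IS the field a.e. on the unit window
(continuity: `envNode_of_ae_eq_decay`; scars: `regPt_of_hasTypeIDecay` + `regPt_iff_of_ae_eq_of_norm_lt_one`). -/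
theorem RootObj.envNode_leaf_of_tame_selfBlowup {M : ℝ} {n : TNode} (hn : RootObj M n) (hb : TameRoot n)
    (hbl : RootBlowup n n) : ∃ A : ℝ, EnvNode A n ∧ LeafNode n := by
  obtain ⟨A, δ, hδ, henv⟩ := (towerObj_of_abTower hn.1).envelope_of_budgetAt hb
  obtain ⟨L, Ū, hŪ, hid⟩ := hbl
  obtain ⟨U', P', H', -, hdec, hae'⟩ := abTower_closed_decay hn.1 hŪ hδ henv
  have hae : ∀ R ∈ Ioo (0 : ℝ) 1,
      ∀ᵐ z ∂(volume.restrict (parabolicCylinder R (0 : ℝ × (EuclideanSpace ℝ (Fin 3))))), U' z.1 z.2 = n.U z.1 z.2 := by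
    intro R hR
    filter_upwards [hid R hR, hae' R hR] with z h1 h2
    rw [← h2, h1]
  exact ⟨A, envNode_of_ae_eq_decay hn.1 hdec hae, fun y hy0 hy1 =>
    (regPt_iff_of_ae_eq_of_norm_lt_one hae hy1).1 (regPt_of_hasTypeIDecay hdec hy0)⟩

/-! ### Y3. Inside the doubly-minimal family: a tame recurrent enveloped leaf, or the self-descending node -/

/-- ★★★ **Y3. THE TWO RECURRENT ENEMIES IN THE MINIMAL FAMILY.**  For a DOUBLY-MINIMAL `n₀`: EITHER (tame) a
rooted object `n` of class `M_c(I)` — TAME, a SELF ROOT BLOW-UP, ROOT-RECURRENT, a gallery limit of `n₀`,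
ENVELOPED on its unit window and a ONE-SCAR LEAF (Y2) — together with a DOUBLY-MINIMAL A–B representative
`(U', P', H')` of its field (X1; `U' = n.U` a.e. on the open past) which is itself TAME (Y0), enveloped with the
same constant, a one-scar leaf, root rated exactly `M_c(I)` and ENERGY-SATURATED at the root (V2), and the
gallery-minimal rate is `m⋆ = M_c(I)`; OR (wild) LEAD sz-p1's SELF-DESCENDING root-recurrent node with its
doubly-minimal representative saturated at the root AND at the `1/4`-satellite (= X2's second alternative). -/
theorem DoublyMin.recurrentLeaf_or_selfDescending_rep {I : ℝ≥0∞} {n₀ : TNode} (h : DoublyMin I n₀) :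
    (∃ (n : TNode) (U' : ℝ → (EuclideanSpace ℝ (Fin 3)) → (EuclideanSpace ℝ (Fin 3))) (P' : ℝ → (EuclideanSpace ℝ (Fin 3)) → ℝ) (H' : ℝ → (EuclideanSpace ℝ (Fin 3)) → (EuclideanSpace ℝ (Fin 3)) →L[ℝ] (EuclideanSpace ℝ (Fin 3))) (A : ℝ),
      RootObj (levelCrit I) n ∧ TameRoot n ∧ RootBlowup n n ∧ IsRootOmegaLimit n.U n.U ∧
      IsGalleryLimit n₀.U n.U ∧ EnvNode A n ∧ LeafNode n ∧
      (∀ R : ℝ, 0 < R →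
        ∀ᵐ z ∂(volume.restrict (parabolicCylinder R (0 : ℝ × (EuclideanSpace ℝ (Fin 3))))), U' z.1 z.2 = n.U z.1 z.2) ∧
      DoublyMin I ⟨U', P', H', 0⟩ ∧ TameRoot ⟨U', P', H', 0⟩ ∧ EnvNode A ⟨U', P', H', 0⟩ ∧
      LeafNode ⟨U', P', H', 0⟩ ∧ (∀ y : (EuclideanSpace ℝ (Fin 3)), RegPt U' y ↔ RegPt n.U y) ∧
      tightRate U' 0 = levelCrit I ∧
      (∀ ρ : ℝ, 0 < ρ → typeIBound (parabolicCylinder ρ (0 : ℝ × (EuclideanSpace ℝ (Fin 3)))) U' P' H' = minLevel I) ∧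
      (∃ mstar : ℝ, ABTower mstar n.U n.P n.H ∧
        (∀ y : (EuclideanSpace ℝ (Fin 3)), ¬ RegPt n.U y → tightRate n.U y = mstar) ∧ mstar = levelCrit I)) ∨
    ∃ (n : TNode) (U' : ℝ → (EuclideanSpace ℝ (Fin 3)) → (EuclideanSpace ℝ (Fin 3))) (P' : ℝ → (EuclideanSpace ℝ (Fin 3)) → ℝ) (H' : ℝ → (EuclideanSpace ℝ (Fin 3)) → (EuclideanSpace ℝ (Fin 3)) →L[ℝ] (EuclideanSpace ℝ (Fin 3))),
      RootObj (levelCrit I) n ∧ ¬ TameRoot n ∧ RootDescends n n ∧ IsRootOmegaLimit n.U n.U ∧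
      IsGalleryLimit n₀.U n.U ∧
      (∀ R : ℝ, 0 < R →
        ∀ᵐ z ∂(volume.restrict (parabolicCylinder R (0 : ℝ × (EuclideanSpace ℝ (Fin 3))))), U' z.1 z.2 = n.U z.1 z.2) ∧
      DoublyMin I ⟨U', P', H', n.y⟩ ∧ (∀ y : (EuclideanSpace ℝ (Fin 3)), RegPt U' y ↔ RegPt n.U y) ∧
      ‖n.y‖ = 1 / 4 ∧ ¬ RegPt U' 0 ∧ ¬ RegPt U' n.y ∧
      (∀ y' : (EuclideanSpace ℝ (Fin 3)), ¬ RegPt n.U y' → tightRate U' y' = levelCrit I ∧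
        ∀ ρ : ℝ, 0 < ρ →
          typeIBound (parabolicCylinder ρ (((0 : ℝ), y') : ℝ × (EuclideanSpace ℝ (Fin 3)))) U' P' H' = minLevel I) ∧
      (∃ mstar : ℝ, ABTower mstar n.U n.P n.H ∧
        (∀ y : (EuclideanSpace ℝ (Fin 3)), ¬ RegPt n.U y → tightRate n.U y = mstar) ∧ mstar = levelCrit I) := by
  have hT : ABTower (levelCrit I) n₀.U n₀.P n₀.H := h.1.1.1
  rcases hT.tameRecurrent_or_selfDescending h.1.1.2 with
      ⟨n, hn, hb, hbl, hgal, -, hω, mstar, hm, -, hsc, -⟩ |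
      ⟨n, hn, ht, hd, hgal, -, hω, mstar, hm, -, hsc, -⟩
  · left
    obtain ⟨A, hE, hleaf⟩ := hn.envNode_leaf_of_tame_selfBlowup hb hbl
    obtain ⟨U', P', H', hAB, hle, hae, hreg, hDM⟩ := h.galleryLimit_rep hgal
    have hD : DoublyMin I ⟨U', P', H', 0⟩ := hDM hn.2 0
    have hc' : ContinuousOn (Function.uncurry U') (Iio 0 ×ˢ univ) := (towerObj_of_abTower hAB).2.1
    have hcn : ContinuousOn (Function.uncurry n.U) (Iio 0 ×ˢ univ) := (towerObj_of_abTower hn.1).2.1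
    have hae1 : ∀ R ∈ Ioo (0 : ℝ) 1,
        ∀ᵐ z ∂(volume.restrict (parabolicCylinder R (0 : ℝ × (EuclideanSpace ℝ (Fin 3))))), n.U z.1 z.2 = U' z.1 z.2 :=
      fun R hR => (hae R hR.1).mono fun z hz => hz.symm
    have hb' : TameRoot ⟨U', P', H', 0⟩ := budgetAt_zero_of_ae_eq hcn hc' hae1 hb
    have h0' : ¬ RegPt U' 0 := fun hr => hn.2 ((hreg 0).1 hr)
    -- the envelope passes to the representative (a.e. equality + continuity, `envNode_of_ae_le_windows`)
    have hE' : EnvNode A ⟨U', P', H', 0⟩ := by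
      refine envNode_of_ae_le_windows (n := ⟨U', P', H', 0⟩) hAB fun R hR => ?_
      filter_upwards [hae R hR.1,
        ae_restrict_mem (isOpen_parabolicCylinder R (0 : ℝ × (EuclideanSpace ℝ (Fin 3)))).measurableSet] with z h1 hz
      have hz' := (mem_parabolicCylinder.1 hz)
      have ht1 : z.1 ∈ Ioo (-1 : ℝ) 0 := by
        refine ⟨?_, by simpa using hz'.1.2⟩
        have h := hz'.1.1
        simp only [Prod.fst_zero] at h
        nlinarith [hR.1, hR.2]
      have hx1 : z.2 ∈ ball (0 : (EuclideanSpace ℝ (Fin 3))) 1 := by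
        have h := hz'.2
        simp only [Prod.snd_zero] at h
        exact mem_ball.2 (h.trans hR.2)
      show ‖U' z.1 z.2‖ ≤ A / (‖z.2‖ + Real.sqrt (-z.1))
      rw [h1]
      exact envNode_iff.1 hE z.1 ht1 z.2 hx1
    have hleaf' : LeafNode ⟨U', P', H', 0⟩ := fun y hy0 hy1 => (hreg y).2 (hleaf y hy0 hy1)
    have hm0 : tightRate U' 0 = tightRate n.U 0 :=
      tightRate_congr_of_ae_eq_of_norm_lt_one hc' hcn (fun R hR => hae R hR.1) (by simp)
    have hex : tightRate U' 0 = levelCrit I := hD.1.tightRate_eq h0'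
    have hmc : mstar = levelCrit I := by rw [← hsc 0 hn.2, ← hm0, hex]
    exact ⟨n, U', P', H', A, hn, hb, hbl, hω, hgal, hE, hleaf, hae, hD, hb', hE', hleaf', hreg, hex,
      fun ρ hρ => hD.energy_local_eq h0' hρ, mstar, hm, hsc, hmc⟩
  · right
    obtain ⟨U', P', H', hAB, hle, hae, hreg, hDM⟩ := h.galleryLimit_rep hgal
    have hD : DoublyMin I ⟨U', P', H', n.y⟩ := hDM hn.2 n.y
    obtain ⟨L, Ū, hLU, haeU, hny, hsat⟩ := hd
    have h0' : ¬ RegPt U' 0 := fun hr => hn.2 ((hreg 0).1 hr)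
    have hy' : ¬ RegPt U' n.y := fun hr => hsat.2 ((hreg n.y).1 hr)
    have hsc' : ∀ y' : (EuclideanSpace ℝ (Fin 3)), ¬ RegPt n.U y' → tightRate U' y' = levelCrit I ∧
        ∀ ρ : ℝ, 0 < ρ →
          typeIBound (parabolicCylinder ρ (((0 : ℝ), y') : ℝ × (EuclideanSpace ℝ (Fin 3)))) U' P' H' = minLevel I := by
      intro y' hy
      have hyU : ¬ RegPt U' y' := fun hr => hy ((hreg y').1 hr)
      exact ⟨hD.1.tightRate_eq hyU, fun ρ hρ => hD.energy_local_eq hyU hρ⟩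
    have hm0 : tightRate U' 0 = tightRate n.U 0 :=
      tightRate_congr_of_ae_eq_of_norm_lt_one (towerObj_of_abTower hAB).2.1
        (towerObj_of_abTower hn.1).2.1 (fun R hR => hae R hR.1) (by simp)
    have hmc : mstar = levelCrit I := by
      rw [← hsc 0 hn.2, ← hm0]
      exact (hsc' 0 hn.2).1
    exact ⟨n, U', P', H', hn, ht, ⟨L, Ū, hLU, haeU, hny, hsat⟩, hω, hgal, hae, hD,
      hreg, hny, h0', hy', hsc', mstar, hm, hsc, hmc⟩

/-! ### Y4. WILD ⇒ the saturated self-descending fixed point -/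

/-- ★★★ **Y4. IN THE WILD BRANCH THE ENEMY IS THE FIXED POINT.**  If NO doubly-minimal object of the level is
tame, then every doubly-minimal object has, among its gallery limits, LEAD sz-p1's SELF-DESCENDING
root-recurrent node — WITH a doubly-minimal representative exactly `M_c(I)`-rated and energy-saturated at its
root and at its `1/4`-satellite, `m⋆ = M_c(I)` (Y3's tame alternative would be a tame doubly-minimal object). -/
theorem DoublyMin.selfDescending_of_wild {I : ℝ≥0∞} {n₀ : TNode} (h : DoublyMin I n₀)
    (hW : ∀ n : TNode, DoublyMin I n → ¬ TameRoot n) :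
    ∃ (n : TNode) (U' : ℝ → (EuclideanSpace ℝ (Fin 3)) → (EuclideanSpace ℝ (Fin 3))) (P' : ℝ → (EuclideanSpace ℝ (Fin 3)) → ℝ) (H' : ℝ → (EuclideanSpace ℝ (Fin 3)) → (EuclideanSpace ℝ (Fin 3)) →L[ℝ] (EuclideanSpace ℝ (Fin 3))),
      RootObj (levelCrit I) n ∧ ¬ TameRoot n ∧ RootDescends n n ∧ IsRootOmegaLimit n.U n.U ∧
      IsGalleryLimit n₀.U n.U ∧
      (∀ R : ℝ, 0 < R →
        ∀ᵐ z ∂(volume.restrict (parabolicCylinder R (0 : ℝ × (EuclideanSpace ℝ (Fin 3))))), U' z.1 z.2 = n.U z.1 z.2) ∧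
      DoublyMin I ⟨U', P', H', n.y⟩ ∧ (∀ y : (EuclideanSpace ℝ (Fin 3)), RegPt U' y ↔ RegPt n.U y) ∧
      ‖n.y‖ = 1 / 4 ∧ ¬ RegPt U' 0 ∧ ¬ RegPt U' n.y ∧
      (∀ y' : (EuclideanSpace ℝ (Fin 3)), ¬ RegPt n.U y' → tightRate U' y' = levelCrit I ∧
        ∀ ρ : ℝ, 0 < ρ →
          typeIBound (parabolicCylinder ρ (((0 : ℝ), y') : ℝ × (EuclideanSpace ℝ (Fin 3)))) U' P' H' = minLevel I) ∧
      (∃ mstar : ℝ, ABTower mstar n.U n.P n.H ∧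
        (∀ y : (EuclideanSpace ℝ (Fin 3)), ¬ RegPt n.U y → tightRate n.U y = mstar) ∧ mstar = levelCrit I) := by
  rcases h.recurrentLeaf_or_selfDescending_rep with
      ⟨n, U', P', H', A, -, -, -, -, -, -, -, -, hD, hb', -⟩ | hR
  · exact absurd hb' (hW _ hD)
  · exact hR

/-! ### Y5. THE TWO-ENEMY NORMAL FORM of ¬23843 -/

/-- ★★★ **Y5. THE TWO-ENEMY NORMAL FORM.**  If 23843 fails then, at the finite scar-carrying energy level `I₀`
of the violator (class `M_c(I₀) ∈ [ε_L, M]`): EITHER (tame) `M_c(I₀) ≤ A_*(I₀)` and a TRIPLY-MINIMAL ONE-SCAR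
LEAF exists (minimal class, minimal energy, minimal envelope constant, saturated on every window — U9–U12),
OR (wild) every doubly-minimal object of the level is wild AND a SELF-DESCENDING root-recurrent node of the
class `M_c(I₀)` exists whose doubly-minimal representative is exactly rated and ENERGY-SATURATED at its root
and at its `1/4`-satellite.  The «enveloped rooted object» escape of X3 is CLOSED: by Y1 + Y0 + X1 it would be
a tame doubly-minimal object, i.e. the first alternative. -/
theorem triplyMin_or_selfDescending_of_not_scarEnvelopeTypeI
    (h : ¬ Summit.NavierStokesRegularity.NavierStokesRegularity.Theses.TypeIQuarterGate.ScarEnvelopeTypeI) :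
    ∃ (M : ℝ) (I₀ : ℝ≥0∞), I₀ < ⊤ ∧ (levelRates I₀).Nonempty ∧ levelCrit I₀ ∈ Icc epsL M ∧
      minLevel I₀ ≤ I₀ ∧
      ((levelCrit I₀ ≤ minEnv I₀ ∧
          ∃ n : TNode, TriplyMin I₀ n ∧ LeafNode n ∧ tightRate n.U 0 = levelCrit I₀) ∨
       ((∀ n : TNode, DoublyMin I₀ n → ¬ TameRoot n) ∧
        ∃ (n : TNode) (U' : ℝ → (EuclideanSpace ℝ (Fin 3)) → (EuclideanSpace ℝ (Fin 3))) (P' : ℝ → (EuclideanSpace ℝ (Fin 3)) → ℝ) (H' : ℝ → (EuclideanSpace ℝ (Fin 3)) → (EuclideanSpace ℝ (Fin 3)) →L[ℝ] (EuclideanSpace ℝ (Fin 3))),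
          RootObj (levelCrit I₀) n ∧ ¬ TameRoot n ∧ RootDescends n n ∧ IsRootOmegaLimit n.U n.U ∧
          (∀ R : ℝ, 0 < R →
            ∀ᵐ z ∂(volume.restrict (parabolicCylinder R (0 : ℝ × (EuclideanSpace ℝ (Fin 3))))), U' z.1 z.2 = n.U z.1 z.2) ∧
          DoublyMin I₀ ⟨U', P', H', n.y⟩ ∧ ‖n.y‖ = 1 / 4 ∧ ¬ RegPt U' 0 ∧ ¬ RegPt U' n.y ∧
          (∀ y' : (EuclideanSpace ℝ (Fin 3)), ¬ RegPt n.U y' → tightRate U' y' = levelCrit I₀ ∧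
            ∀ ρ : ℝ, 0 < ρ →
              typeIBound (parabolicCylinder ρ (((0 : ℝ), y') : ℝ × (EuclideanSpace ℝ (Fin 3)))) U' P' H' = minLevel I₀))) := by
  obtain ⟨M, I₀, hI₀, hne, hIcc, -, -⟩ := exactCritical_of_not_scarEnvelopeTypeI h
  refine ⟨M, I₀, hI₀, hne, hIcc, minLevel_le_self hI₀ hne, ?_⟩
  by_cases htame : ∃ n : TNode, DoublyMin I₀ n ∧ TameRoot n
  · exact Or.inl ⟨levelCrit_le_minEnv htame, exists_triplyMin_leaf hI₀ hne htame⟩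
  · push Not at htame
    obtain ⟨n₀, hn₀⟩ := doublyMin_nonempty hI₀ hne
    obtain ⟨n, U', P', H', hn, ht, hd, hω, -, hae, hD, -, hny, h0, hy, hsc, -⟩ :=
      hn₀.selfDescending_of_wild htame
    exact Or.inr ⟨htame, n, U', P', H', hn, ht, hd, hω, hae, hD, hny, h0, hy, hsc⟩

/-- Y5b. **23843 from the two exclusions «no triply-minimal object is a one-scar leaf» and «no self-descending
node of the critical class has a doubly-minimal representative»** (the second in the weak form: no rooted,
non-tame, self-descending, root-recurrent object of class `M_c(I)` whose field has a doubly-minimal A–B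
representative). -/
theorem scarEnvelopeTypeI_of_noTriplyMinLeaf_noSelfDescendingMin
    (h₁ : ∀ (I : ℝ≥0∞) (n : TNode), TriplyMin I n → ¬ LeafNode n)
    (h₂ : ∀ (I : ℝ≥0∞) (n : TNode) (U' : ℝ → (EuclideanSpace ℝ (Fin 3)) → (EuclideanSpace ℝ (Fin 3))) (P' : ℝ → (EuclideanSpace ℝ (Fin 3)) → ℝ) (H' : ℝ → (EuclideanSpace ℝ (Fin 3)) → (EuclideanSpace ℝ (Fin 3)) →L[ℝ] (EuclideanSpace ℝ (Fin 3))),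
      RootObj (levelCrit I) n → ¬ TameRoot n → RootDescends n n → IsRootOmegaLimit n.U n.U →
      (∀ R : ℝ, 0 < R →
        ∀ᵐ z ∂(volume.restrict (parabolicCylinder R (0 : ℝ × (EuclideanSpace ℝ (Fin 3))))), U' z.1 z.2 = n.U z.1 z.2) →
      ¬ DoublyMin I ⟨U', P', H', n.y⟩) :
    Summit.NavierStokesRegularity.NavierStokesRegularity.Theses.TypeIQuarterGate.ScarEnvelopeTypeI := by
  by_contra h
  obtain ⟨M, I₀, -, -, -, -, hcases⟩ := triplyMin_or_selfDescending_of_not_scarEnvelopeTypeI h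
  rcases hcases with ⟨-, n, hn, hleaf, -⟩ | ⟨-, n, U', P', H', hn, ht, hd, hω, hae, hD, -⟩
  · exact h₁ I₀ n hn hleaf
  · exact h₂ I₀ n U' P' H' hn ht hd hω hae hD

end Recurrent


end Summit.NavierStokesRegularity.NavierStokesRegularity.Cruxes.ScarEnvelopeTypeI.ZoomDictionary
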